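/-
Copyright (c) 2026. All rights reserved.
Released under Apache 2.0 license as described in the file LICENSE.
Authors: abc-iut cell — seat abc-iut-f-140 (block F fact-proving wave; FACT-LIST row F-2772).
-/
import Literature.AnabelianGeometry.SemiGraphs.IncoherentBouquet
import Literature.AnabelianGeometry.SemiGraphs.ProfiniteHomToAnabPullback
import Literature.AnabelianGeometry.SemiGraphs.TemperedAnabelianTowerWitness
import HarnessLib

/-!
# The loop of TRIVIAL anabelioids and its explicit tempered fundamental group `π₁^temp = ℤ`
# ([SemiAnbd] Def. 3.5, Prop. 3.6 (ii) by hand for one object off the Prop-3.6 hypotheses)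

Mochizuki, *Semi-graphs of anabelioids*, Publ. RIMS **42** (2006), §3: p. 33 (`B^temp(Π)`, Def. 3.1 (i)
tempered groups), p. 36 (`B^cov(G)`), Def. 3.5 (i)(ii) p. 37 (coverings, tempered coverings), p. 38 /
Prop. 3.6 (ii) (`B^temp(π₁^temp(G)) ⥲ B^temp(G)`), Thm. 3.7 (i)/(iii) pp. 40–41 (verticial / edge-like subgroups
via the restrictions `S ↦ S_v`, `S ↦ S_e`) [cite: MochizukiSemiAnbd2006, Prop 3.6(ii) p.38].

DEFINITIONS file (abc-iut cell, block F, seat abc-iut-f-140; KEYED row F2772 — base object of the witness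
`TemperedEdgeLikeCentralizerSchemaNegative.lean`, which refutes the universal closure of the FACT-LIST schema
F-2772 `EdgeLikeCentralizerAt` at this object).  In the pattern of abc-iut-L3-t6's `OneVertexEdgelessChart`
(explicit chart `π₁^temp = Π_v` of a one-vertex edgeless presentation) — here for a presentation WITH A CLOSED
EDGE, where the tempered fundamental group is no longer a vertex group:

* `trivialLoop` — the loop (one vertex, one closed edge; underlying semi-graph abc-iut-L3-t5's
  `IncoherentBouquet.loop`) ALL of whose constituent anabelioids are TRIVIAL (`Π_v = Π_e = 1`);
* `shift S` — the MONODROMY of a covering `S = (S_v, S_e, S_e ≅ S_v, S_e ≅ S_v)`: the permutation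
  `glue_true ∘ glue_false⁻¹` of `S_v`; `toZSet S` — `S_v` as a discrete continuous `ℤ`-set (`n ↦ shiftⁿ`);
  `ofZSet X` — conversely a `ℤ`-set glued by `id` and by its generator; `isTempered_covObj` — EVERY covering is
  tempered (split by the one-point covering `pointCov`, all groups being trivial);
* `trivialLoopEquiv : B^temp(trivialLoop) ≌ B^temp(ℤ)` and the EXPLICIT chart `trivialLoopChart` with
  **`π₁^temp(trivialLoop) = ℤ`** (`Multiplicative ℤ`, discrete: a countable discrete group is tempered,
  `isTempered_of_discreteTopology`, and second countable);
* `inverse_comp_restrictV` / `inverse_comp_restrictE` — for this chart `equiv.inverse ⋙ ι ⋙ restrictV v` and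
  `equiv.inverse ⋙ ι ⋙ restrictE e` ARE `BTemp.res (1 : 1 → ℤ)` (definitionally): the trivial homomorphism is the
  verticial and the edge homomorphism.

HONEST FRAMING.  `trivialLoop` is NOT a Prop-3.6 / Cor-3.9 object (a trivial edge group is neither aloof nor
elevated as typed) — not claimed; it is a witness object (the topological fundamental group of a circle of trivial
anabelioids is `ℤ`).  Definitions + definitional laws + the temperedness theorem; no statement of the paper is
retyped, no `Prop` fact is named, no instance / notation.  Nothing here takes a side on [IUTchIII] Cor. 3.12.
-/

noncomputable section

open CategoryTheory Topology

namespace Literature.AnabelianGeometry.SemiGraphs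

namespace ProfiniteSemiGraph

open Literature.AlgebraicGeometry.Frobenioids.QuasiTemperoid.BTempConnected (hom_ρ hom_ext_apply
  ρ_one_apply ρ_mul_apply ρ_inv_apply ρ_apply_inv)
open IncoherentBouquet (loop trivialObj)

namespace TrivialLoop

/-! ### 1. The loop of trivial anabelioids -/

/-- **The loop of trivial anabelioids** ([SemiAnbd] Def. 2.1 p. 22, local presentation): on the loop
(one vertex, one closed edge with both branches at the vertex) every constituent group is trivial,
`Π_v = Π_e = 1`, and the branch maps are the (only) homomorphisms `1 → 1`.  A DEFINITION (witness object);
nothing of the paper is asserted. [cite: MochizukiSemiAnbd2006, Def 2.1 p.22] -/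
@[reducible] def trivialLoop : ProfiniteSemiGraph.{0} where
  graph := loop
  Gv _ := PUnit
  Ge _ := PUnit
  brHom _ _ _ := 1

/-- The tempered fundamental group to be: the infinite cyclic group, written multiplicatively, with the
DISCRETE topology. [cite: MochizukiSemiAnbd2006, Prop 3.6(ii) p.38] -/
abbrev Z : Type := Multiplicative ℤ

/-- The trivial homomorphism `Π_v = 1 → ℤ` (it will be THE verticial and THE edge homomorphism of the
explicit chart). [cite: MochizukiSemiAnbd2006, Thm 3.7(i) p.40] -/
abbrev ι₀ : PUnit.{1} →ₜ* Z := 1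

/-! ### 2. Coverings of the trivial loop: a countable set with a permutation -/

section Glue

variable (S : CovObj trivialLoop)

/-- `glue⁻¹ (glue y) = y` for a gluing of a covering of the trivial loop. [cite: MochizukiSemiAnbd2006, §3 p.36] -/
private theorem glue_inv_hom (b : Bool) (y : (S.SE ()).obj.V) :
    (S.glue b () rfl).inv.hom.hom ((S.glue b () rfl).hom.hom.hom y) = y :=
  ConcreteCategory.congr_hom (congrArg (fun φ : S.SE () ⟶ S.SE () => φ.hom.hom) (S.glue b () rfl).hom_inv_id) y

/-- `glue (glue⁻¹ x) = x` for a gluing of a covering of the trivial loop. [cite: MochizukiSemiAnbd2006, §3 p.36] -/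
private theorem glue_hom_inv (b : Bool) (x : (S.SV ()).obj.V) :
    (S.glue b () rfl).hom.hom.hom ((S.glue b () rfl).inv.hom.hom x) = x :=
  ConcreteCategory.congr_hom (congrArg
    (fun φ : (BTemp.res (trivialLoop.brHom b () rfl)).obj (S.SV ()) ⟶
        (BTemp.res (trivialLoop.brHom b () rfl)).obj (S.SV ()) => φ.hom.hom)
    (S.glue b () rfl).inv_hom_id) x

/-- The gluing of a covering `S` of the trivial loop along the branch `b`, as a bijection `S_e ≃ S_v` of the
underlying sets (the constituent groups being trivial, a gluing is just a bijection).
[cite: MochizukiSemiAnbd2006, §3 p.36] -/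
def glueEquiv (b : Bool) : (S.SE ()).obj.V ≃ (S.SV ()).obj.V where
  toFun := (S.glue b () rfl).hom.hom.hom
  invFun := (S.glue b () rfl).inv.hom.hom
  left_inv := glue_inv_hom S b
  right_inv := glue_hom_inv S b

/-- **The monodromy of a covering of the trivial loop**: the permutation `S_v ≃ S_v`, "enter the edge through
the branch `false`, leave through the branch `true`" (`glue_true ∘ glue_false⁻¹`).
[cite: MochizukiSemiAnbd2006, Def 3.5(i) p.37] -/
def shift : Equiv.Perm (S.SV ()).obj.V := (glueEquiv S false).symm.trans (glueEquiv S true)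

/-- The monodromy on a glued point: `shift (glue_false y) = glue_true y`. [cite: MochizukiSemiAnbd2006, Def 3.5(i) p.37] -/
theorem shift_glue_false (y : (S.SE ()).obj.V) :
    shift S ((S.glue false () rfl).hom.hom.hom y) = (S.glue true () rfl).hom.hom.hom y :=
  congrArg (glueEquiv S true) ((glueEquiv S false).symm_apply_apply y)

end Glue

/-- Monodromies are natural: a morphism of coverings intertwines the monodromies.
[cite: MochizukiSemiAnbd2006, §3 p.36] -/
theorem fV_shift {S T : CovObj trivialLoop} (f : S ⟶ T) (x : (S.SV ()).obj.V) :
    (f.fV ()).hom.hom (shift S x) = shift T ((f.fV ()).hom.hom x) := by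
  -- write `x = glue_false y`
  obtain ⟨y, rfl⟩ : ∃ y, (S.glue false () rfl).hom.hom.hom y = x :=
    ⟨(glueEquiv S false).symm x, (glueEquiv S false).apply_symm_apply x⟩
  have hglue : ∀ b : Bool, (T.glue b () rfl).hom.hom.hom ((f.fE ()).hom.hom y) =
      (f.fV ()).hom.hom ((S.glue b () rfl).hom.hom.hom y) := fun b =>
    ConcreteCategory.congr_hom (congrArg
      (fun φ : S.SE () ⟶ (BTemp.res (trivialLoop.brHom b () rfl)).obj (T.SV ()) => φ.hom.hom)
      (f.comm b () rfl)) y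
  rw [shift_glue_false, ← hglue false, shift_glue_false, hglue true]

/-- Intertwining permutations are intertwined at every integer power. [folklore] -/
private theorem semiconj_zpow {α β : Type*} {φ : α → β} {σ : Equiv.Perm α} {τ : Equiv.Perm β}
    (h : ∀ x, φ (σ x) = τ (φ x)) (n : ℤ) (x : α) : φ ((σ ^ n) x) = (τ ^ n) (φ x) := by
  induction n using Int.induction_on generalizing x with
  | zero => simp
  | succ n ih => rw [zpow_add_one, zpow_add_one, Equiv.Perm.mul_apply, Equiv.Perm.mul_apply, ih, h]
  | pred n ih =>
    have h' : ∀ x, φ (σ⁻¹ x) = τ⁻¹ (φ x) := fun x => by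
      rw [Equiv.Perm.eq_inv_iff_eq, ← h, ← Equiv.Perm.mul_apply, mul_inv_cancel, Equiv.Perm.one_apply]
    rw [zpow_sub_one, zpow_sub_one, Equiv.Perm.mul_apply, Equiv.Perm.mul_apply, ih, h']

/-! ### 3. `B^temp(trivialLoop) ⥤ B^temp(ℤ)`: the fibre at the vertex with its monodromy -/

/-- The `ℤ`-set of a covering of the trivial loop: the fibre `S_v` on which `n` acts by the `n`-th power of
the monodromy (countable; stabilisers open since `ℤ` is discrete). [cite: MochizukiSemiAnbd2006, Prop 3.6(ii) p.38] -/
def toZSet (S : CovObj trivialLoop) : BTemp Z :=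
  letI : MulAction Z (S.SV ()).obj.V := MulAction.compHom _ (zpowersHom (Equiv.Perm (S.SV ()).obj.V) (shift S))
  ⟨Action.ofMulAction Z (S.SV ()).obj.V, ⟨(S.SV ()).property.1, fun _ => isOpen_discrete _⟩⟩

/-- The action of `toZSet S` in closed form: `n · x = shift^n x`. [cite: MochizukiSemiAnbd2006, Prop 3.6(ii) p.38] -/
theorem toZSet_ρ (S : CovObj trivialLoop) (n : ℤ) (x : (S.SV ()).obj.V) :
    (toZSet S).obj.ρ (Multiplicative.ofAdd n) x = (shift S ^ n) x := by
  letI : MulAction Z (S.SV ()).obj.V := MulAction.compHom _ (zpowersHom (Equiv.Perm (S.SV ()).obj.V) (shift S))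
  change (Action.ofMulAction Z (S.SV ()).obj.V).ρ (Multiplicative.ofAdd n) x = _
  rw [Action.ofMulAction_apply]
  change (zpowersHom (Equiv.Perm (S.SV ()).obj.V) (shift S) (Multiplicative.ofAdd n)) • x = _
  rw [zpowersHom_apply, toAdd_ofAdd, Equiv.Perm.smul_def]

/-- The same for an arbitrary element of `ℤ`. [cite: MochizukiSemiAnbd2006, Prop 3.6(ii) p.38] -/
theorem toZSet_ρ' (S : CovObj trivialLoop) (g : Z) (x : (S.SV ()).obj.V) :
    (toZSet S).obj.ρ g x = (shift S ^ (Multiplicative.toAdd g)) x := by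
  rw [← toZSet_ρ, ofAdd_toAdd]

/-- **`B^cov(trivialLoop) ⥤ (ℤ-sets)`**, `S ↦ (S_v, monodromy)`, on morphisms the vertex component.
[cite: MochizukiSemiAnbd2006, Prop 3.6(ii) p.38] -/
def toZSetFunctor : CovObj trivialLoop ⥤ BTemp Z where
  obj := toZSet
  map {S T} f := ObjectProperty.homMk
    { hom := (f.fV ()).hom.hom
      comm := fun g => by
        ext x
        change (f.fV ()).hom.hom ((toZSet S).obj.ρ g x) = (toZSet T).obj.ρ g ((f.fV ()).hom.hom x)
        rw [toZSet_ρ', toZSet_ρ']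
        exact semiconj_zpow (fV_shift f) _ x }
  map_id S := hom_ext_apply fun _ => rfl
  map_comp f g := hom_ext_apply fun _ => rfl

/-- `B^temp(trivialLoop) ⥤ B^temp(ℤ)` (restriction of `toZSetFunctor` to the tempered coverings).
[cite: MochizukiSemiAnbd2006, Prop 3.6(ii) p.38] -/
def functor : BTempCat trivialLoop ⥤ BTemp Z := ObjectProperty.ι _ ⋙ toZSetFunctor

/-! ### 4. `B^temp(ℤ) ⥤ B^temp(trivialLoop)`: a `ℤ`-set as a covering glued by its generator -/

/-- The action of the generator `1 ∈ ℤ` on a `ℤ`-set, as a permutation. [cite: MochizukiSemiAnbd2006, §3 p.33] -/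
def genPerm (X : BTemp Z) : Equiv.Perm X.obj.V where
  toFun := X.obj.ρ (Multiplicative.ofAdd 1)
  invFun := X.obj.ρ (Multiplicative.ofAdd 1)⁻¹
  left_inv := ρ_inv_apply X _
  right_inv := ρ_apply_inv X _

/-- `genPerm X` is the action of the generator. [cite: MochizukiSemiAnbd2006, §3 p.33] -/
@[simp] theorem genPerm_apply (X : BTemp Z) (x : X.obj.V) : genPerm X x = X.obj.ρ (Multiplicative.ofAdd 1) x :=
  rfl

/-- Powers of the generator act by the corresponding element of `ℤ`. [cite: MochizukiSemiAnbd2006, §3 p.33] -/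
theorem genPerm_zpow_apply (X : BTemp Z) (n : ℤ) (x : X.obj.V) :
    (genPerm X ^ n) x = X.obj.ρ (Multiplicative.ofAdd n) x := by
  induction n using Int.induction_on generalizing x with
  | zero => rw [zpow_zero, Equiv.Perm.one_apply, ofAdd_zero, ρ_one_apply]
  | succ n ih =>
    rw [zpow_add_one, Equiv.Perm.mul_apply, genPerm_apply, ih, ← ρ_mul_apply, ← ofAdd_add,
      add_comm]
  | pred n ih =>
    have h' : ∀ y, (genPerm X)⁻¹ y = X.obj.ρ (Multiplicative.ofAdd (-1)) y := fun y => by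
      rw [Equiv.Perm.inv_def, Equiv.symm_apply_eq, genPerm_apply, ← ρ_mul_apply, ← ofAdd_add,
        add_neg_cancel, ofAdd_zero, ρ_one_apply]
    rw [zpow_sub_one, Equiv.Perm.mul_apply, h', ih, ← ρ_mul_apply, ← ofAdd_add, sub_eq_add_neg, add_comm]

/-- The covering of the trivial loop attached to a `ℤ`-set `X`: fibre `X` (trivial action of the trivial
groups) over the vertex and over the edge, glued by the identity along the branch `false` and by the
generator of `ℤ` along the branch `true`. [cite: MochizukiSemiAnbd2006, Def 3.5(i) p.37] -/
def ofZSet (X : BTemp Z) : CovObj trivialLoop where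
  SV _ := (BTemp.res ι₀).obj X
  SE _ := (BTemp.res ι₀).obj X
  glue b _ _ := match b with
    | false => BTemp.isoOfEquiv (Equiv.refl _) fun _ _ => rfl
    | true => BTemp.isoOfEquiv (genPerm X) fun g x => by
        change X.obj.ρ (Multiplicative.ofAdd 1) (X.obj.ρ 1 x) = X.obj.ρ 1 (X.obj.ρ (Multiplicative.ofAdd 1) x)
        rw [ρ_one_apply, ρ_one_apply]

/-- The gluing of `ofZSet X` along `false` is the identity. [cite: MochizukiSemiAnbd2006, Def 3.5(i) p.37] -/
@[simp] theorem ofZSet_glue_false (X : BTemp Z) (h : loop.abuts false = some ()) (x : X.obj.V) :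
    ((ofZSet X).glue false () h).hom.hom.hom x = x := rfl

/-- The gluing of `ofZSet X` along `true` is the generator of `ℤ`. [cite: MochizukiSemiAnbd2006, Def 3.5(i) p.37] -/
@[simp] theorem ofZSet_glue_true (X : BTemp Z) (h : loop.abuts true = some ()) (x : X.obj.V) :
    ((ofZSet X).glue true () h).hom.hom.hom x = X.obj.ρ (Multiplicative.ofAdd 1) x := rfl

/-- The monodromy of `ofZSet X` is the generator of `ℤ`. [cite: MochizukiSemiAnbd2006, Def 3.5(i) p.37] -/
theorem shift_ofZSet (X : BTemp Z) : shift (ofZSet X) = genPerm X := Equiv.ext fun _ => rfl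

/-- The one-point covering of the trivial loop (the final object of `B^cov`). [cite: MochizukiSemiAnbd2006, §3 p.36] -/
def pointCov : CovObj trivialLoop where
  SV _ := trivialObj PUnit PUnit
  SE _ := trivialObj PUnit PUnit
  glue _ _ _ := BTemp.isoOfEquiv (Equiv.refl _) fun _ _ => rfl

/-- **Every covering of the trivial loop is tempered** ([SemiAnbd] Def. 3.5 (ii)): all constituent groups
being trivial, the one-point covering splits everything. [cite: MochizukiSemiAnbd2006, Def 3.5(ii) p.37] -/
theorem isTempered_covObj (S : CovObj trivialLoop) : S.IsTempered := fun _ =>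
  ⟨pointCov, ⟨fun _ => inferInstanceAs (Finite PUnit), fun _ => inferInstanceAs (Finite PUnit)⟩,
    ⟨fun _ => ⟨PUnit.unit⟩, fun _ => ⟨PUnit.unit⟩⟩, fun q _ => by
      rcases q with ⟨v, s⟩ | ⟨e, s⟩
      · intro _ g _
        obtain rfl : g = 1 := Subsingleton.elim _ _
        exact ρ_one_apply _ s
      · intro _ g _
        obtain rfl : g = 1 := Subsingleton.elim _ _
        exact ρ_one_apply _ s⟩

/-- **`(ℤ-sets) ⥤ B^cov(trivialLoop)`**, `X ↦ ofZSet X`. [cite: MochizukiSemiAnbd2006, Prop 3.6(ii) p.38] -/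
def ofZSetFunctor : BTemp Z ⥤ CovObj trivialLoop where
  obj := ofZSet
  map {X Y} φ :=
    { fV := fun _ => (BTemp.res ι₀).map φ
      fE := fun _ => (BTemp.res ι₀).map φ
      comm := fun b _ _ => by
        cases b
        · exact hom_ext_apply fun _ => rfl
        · refine hom_ext_apply fun x => ?_
          change Y.obj.ρ (Multiplicative.ofAdd 1) (φ.hom.hom x) = φ.hom.hom (X.obj.ρ (Multiplicative.ofAdd 1) x)
          exact (hom_ρ φ _ x).symm }
  map_id X := CovHom.ext (funext fun _ => rfl) (funext fun _ => rfl)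
  map_comp φ ψ := CovHom.ext (funext fun _ => rfl) (funext fun _ => rfl)

/-- `B^temp(ℤ) ⥤ B^temp(trivialLoop)` (every covering being tempered). [cite: MochizukiSemiAnbd2006, Prop 3.6(ii) p.38] -/
def inverse : BTemp Z ⥤ BTempCat trivialLoop :=
  ObjectProperty.lift _ ofZSetFunctor fun X => isTempered_covObj (ofZSet X)

/-! ### 5. The equivalence `B^temp(trivialLoop) ≌ B^temp(ℤ)` and the explicit chart -/

/-- A tempered covering `S` of the trivial loop is isomorphic to the covering rebuilt from its `ℤ`-set
`(S_v, monodromy)`: identity on `S_v`, the gluing `glue_false` on `S_e`. [cite: MochizukiSemiAnbd2006, Prop 3.6(ii) p.38] -/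
def unitIsoApp (S : BTempCat trivialLoop) : S ≅ inverse.obj (functor.obj S) :=
  ObjectProperty.isoMk _ (CovObj.isoOfComponents
    (fun _ => BTemp.isoOfEquiv (Equiv.refl _) fun g x => by
      obtain rfl : g = 1 := Subsingleton.elim _ _
      change (S.obj.SV ()).obj.ρ 1 x = (toZSet S.obj).obj.ρ 1 x
      rw [ρ_one_apply, ρ_one_apply])
    (fun _ => BTemp.isoOfEquiv (glueEquiv S.obj false) fun g y => by
      obtain rfl : g = 1 := Subsingleton.elim _ _
      change glueEquiv S.obj false ((S.obj.SE ()).obj.ρ 1 y) = (toZSet S.obj).obj.ρ 1 (glueEquiv S.obj false y)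
      rw [ρ_one_apply, ρ_one_apply])
    fun b _ _ => by
      cases b
      · exact hom_ext_apply fun _ => rfl
      · refine hom_ext_apply fun y => ?_
        change (toZSet S.obj).obj.ρ (Multiplicative.ofAdd 1) ((S.obj.glue false () rfl).hom.hom.hom y) =
          (S.obj.glue true () rfl).hom.hom.hom y
        rw [toZSet_ρ, zpow_one, shift_glue_false])

/-- The `ℤ`-set of the covering built from `X` has the action of `X`. [cite: MochizukiSemiAnbd2006, Prop 3.6(ii) p.38] -/
theorem toZSet_ofZSet_ρ (X : BTemp Z) (g : Z) (x : X.obj.V) :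
    (toZSet (ofZSet X)).obj.ρ g x = X.obj.ρ g x := by
  have h1 := toZSet_ρ' (ofZSet X) g x
  have h2 := genPerm_zpow_apply X (Multiplicative.toAdd g) x
  rw [ofAdd_toAdd] at h2
  exact h1.trans ((congrArg (fun σ : Equiv.Perm ((ofZSet X).SV ()).obj.V => (σ ^ Multiplicative.toAdd g) x)
    (shift_ofZSet X)).trans h2)

/-- The `ℤ`-set of the covering built from `X` is `X` (same set; the monodromy is the generator).
[cite: MochizukiSemiAnbd2006, Prop 3.6(ii) p.38] -/
def counitIsoApp (X : BTemp Z) : functor.obj (inverse.obj X) ≅ X :=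
  BTemp.isoOfEquiv (Equiv.refl _) fun g x => toZSet_ofZSet_ρ X g x

/-- **`B^temp(trivialLoop) ≌ B^temp(ℤ)`**: a tempered covering of the loop of trivial anabelioids IS a
countable set with a permutation, i.e. a discrete continuous `ℤ`-set (Prop. 3.6 (ii) for this object, by
hand). [cite: MochizukiSemiAnbd2006, Prop 3.6(ii) p.38] -/
def trivialLoopEquiv : BTempCat trivialLoop ≌ BTemp Z :=
  CategoryTheory.Equivalence.mk functor inverse
    (NatIso.ofComponents unitIsoApp fun {S T} f => ObjectProperty.hom_ext _
      (CovHom.ext (funext fun _ => hom_ext_apply fun _ => rfl)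
        (funext fun _ => hom_ext_apply fun y => by
          change (glueEquiv T.obj false) ((f.hom.fE ()).hom.hom y) =
            (f.hom.fV ()).hom.hom (glueEquiv S.obj false y)
          exact ConcreteCategory.congr_hom (congrArg
            (fun φ : S.obj.SE () ⟶ (BTemp.res (trivialLoop.brHom false () rfl)).obj (T.obj.SV ()) =>
              φ.hom.hom) (f.hom.comm false () rfl)) y)))
    (NatIso.ofComponents counitIsoApp fun _ => hom_ext_apply fun _ => rfl)

/-- The inverse of `trivialLoopEquiv` is `inverse` (definitionally). [cite: MochizukiSemiAnbd2006, Prop 3.6(ii) p.38] -/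
theorem trivialLoopEquiv_inverse : trivialLoopEquiv.inverse = inverse := rfl

/-- **The explicit tempered fundamental group of the loop of trivial anabelioids: `π₁^temp = ℤ`**
(discrete; a countable discrete group is tempered, and second countable).
[cite: MochizukiSemiAnbd2006, Prop 3.6(ii) p.38] -/
def trivialLoopChart : TemperedPiChart trivialLoop where
  G := Z
  isTempered :=
    haveI : Countable Z := inferInstanceAs (Countable ℤ)
    isTempered_of_discreteTopology
  secondCountableTopology := inferInstanceAs (SecondCountableTopology ℤ)
  equiv := trivialLoopEquiv

/-- For the explicit chart, `equiv.inverse ⋙ ι ⋙ restrictV v` IS `BTemp.res (1 : 1 → ℤ)` (definitionally).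
[cite: MochizukiSemiAnbd2006, Thm 3.7(i) p.40] -/
theorem inverse_comp_restrictV (v : loop.Vertex) :
    trivialLoopChart.equiv.inverse ⋙ ObjectProperty.ι _ ⋙ restrictV trivialLoop v = BTemp.res ι₀ := rfl

/-- For the explicit chart, `equiv.inverse ⋙ ι ⋙ restrictE e` IS `BTemp.res (1 : 1 → ℤ)` (definitionally).
[cite: MochizukiSemiAnbd2006, Thm 3.7(iii) p.41] -/
theorem inverse_comp_restrictE (e : loop.Edge) :
    trivialLoopChart.equiv.inverse ⋙ ObjectProperty.ι _ ⋙ restrictE trivialLoop e = BTemp.res ι₀ := rfl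

end TrivialLoop

end ProfiniteSemiGraph

end Literature.AnabelianGeometry.SemiGraphs

end
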